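import Summits.QuantumAdvantage.QuantumAdvantage.Theorems.PebbleDialA
import Literature.Computability.Complexity.UnboundedErrorSignRank
import Literature.Computability.Complexity.BakerGillSolovay

/-!
# PerceptronDial laws (tree twin of the lens-3 g16 node, laws only)

This file is §1–§5, §6 (minus `Assembly`/`closes`), §7–§9 of `run/shared/lean/pub/decomp-qadv/decomp-qadv-lens-3/g16/PerceptronDial.lean`
verbatim under the `Theorems` namespace: the threshold-dial solver classes `ThrXor` (`THR∘XOR`) and `MajQuad` (`MAJ∘XOR∘AND₂`) on the
ANF table bits, the rungs `ThrRung(NU)`, `VoteRung2(NU)` and the residual shape `PercLift`; the certified translations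
(`thrRungNU_iff`, `voteRung2NU_iff`, `voteRung2_iff`); the inner-product face and ★ `thrRungNU : ThrRungNU` (Forster); the split laws
`liftA_iff`, `anfResidual_iff`; the discriminator edge `voteRung2NU_of_face`; the quadratic-key face `qkeyFace` with
`KeyBias → VoteRung2NU`; the dictionary `isAffIn_bits` and the presentation-free leaf `CoreBias` with `CoreBias → KeyBias`.
Offered to the writer / census for landing; 0 sorry.
-/

set_option linter.dupNamespace false

noncomputable section

namespace Summit.QuantumAdvantage.QuantumAdvantage.Theorems.PerceptronDial

open Finset
open Literature.Computability.Complexity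
open Literature.Computability.QuantumComplexity
open Literature.Computability.QuantumComplexity.BuzetChailloux (bxor zeroVec)
open Summit.QuantumAdvantage.QuantumAdvantage.Theses.AnfPresentation
  (AnfResidual RungA LiftA NearExactIsExact SignedExactSliceIsLift AnfEquiv)
open Summit.QuantumAdvantage.QuantumAdvantage.Theorems.HintDial
  (IsDualOf forrelation_eq_one_of_isDualOf flipConst value_flipConst rungA_of_anfResidual)
open Summit.QuantumAdvantage.QuantumAdvantage.Theorems.HintDial.Automaton
  (bd sgl mv MM blTable eval_blTable bd_sgl_left bd_bxor_right dualFn dualFn_append isDualOf_blTable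
    bit_bd bit_decide_and signOf_bd mv_bxor mv_eq_iff bxor_left_eq_iff' bd_zeroVec_right)
open Summit.QuantumAdvantage.QuantumAdvantage.Theorems.HintDial (bit_xor bit_and bit_not bit_eq_ite bit_decide_odd bit_injective bit_mul_self bit_false eval_bit)
open CubicForm (bit)
open DerivativeWalsh (W)
open Summit.QuantumAdvantage.QuantumAdvantage.Theorems.PebbleDial (AnfIdx bitsFG bits)

variable {n k : ℕ}

/-! ## §1 The two solver classes of the threshold dial -/

/-- The `±1` character of a set of table positions: `χ_S(x) = ∏_{i ∈ S} (-1)^{x_i}`. -/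
def chi (S : Finset (AnfIdx n)) (x : AnfIdx n → Bool) : ℝ := ∏ i ∈ S, signOf (x i)

/-- A `THR∘XOR` circuit (perceptron over parities) reading the table bits of arity-`n` ANF instances:
`size` parity gates `gate i` with arbitrary REAL weights `wt i`; it accepts iff `∑ i, wt i · χ_{gate i}(x) > 0`. -/
structure ThrXorCkt (n : ℕ) where
  size : ℕ
  wt : Fin size → ℝ
  gate : Fin size → Finset (AnfIdx n)

/-- the weighted vote of a `THR∘XOR` circuit -/
def ThrXorCkt.val (C : ThrXorCkt n) (x : AnfIdx n → Bool) : ℝ := ∑ i, C.wt i * chi (C.gate i) x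

/-- polynomial size (in the arity; the code length is `Θ(n³)`, so this is polynomial size in the input length) -/
def IsThrXorFamily (C : (n : ℕ) → ThrXorCkt n) : Prop := ∃ p : Polynomial ℕ, ∀ n, (C n).size ≤ p.eval n

/-- acceptance of an instance by a family -/
def tAccepts (C : (n : ℕ) → ThrXorCkt n) (I : CubicANFPair) : Prop := 0 < (C I.n).val (bits I)

/-- ★ the class `THR∘XOR` (non-uniform, polynomial size, UNBOUNDED real weights): languages that agree on instance codes
with some polynomial-size perceptron-of-parities family (membership off codes is unconstrained). -/
def ThrXor : Set (Language Bool) :=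
  {L | ∃ C, IsThrXorFamily C ∧ ∀ I : CubicANFPair, I.encode ∈ L ↔ tAccepts C I}

/-- A quadratic phase gate `φ_{c,S}(x) = c ⊕ ⊕_{(i,j) ∈ S} x_i x_j` (pairs `(i,i)` give the linear terms): one
`XOR∘AND₂` gate, i.e. one `𝔽₂`-polynomial of degree `≤ 2` in the table bits. -/
def qphase (c : Bool) (S : Finset (AnfIdx n × AnfIdx n)) (x : AnfIdx n → Bool) : Bool :=
  xor c (decide (Odd (S.filter fun ij => x ij.1 && x ij.2).card))

/-- A `MAJ∘XOR∘AND₂` circuit: an UNWEIGHTED majority vote of `size` quadratic phase gates (repetitions allowed, so this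
is exactly «polynomially bounded integer weights»); it accepts iff `∑ i, (-1)^{φ_i(x)} > 0`. -/
structure MajQuadCkt (n : ℕ) where
  size : ℕ
  cst : Fin size → Bool
  mono : Fin size → Finset (AnfIdx n × AnfIdx n)

/-- the vote of a `MAJ∘XOR∘AND₂` circuit -/
def MajQuadCkt.val (C : MajQuadCkt n) (x : AnfIdx n → Bool) : ℝ := ∑ i, signOf (qphase (C.cst i) (C.mono i) x)

/-- PerceptronDialLawsA helper `IsMajQuadFamily` (decomp-qadv land package; see the module docstring). -/
def IsMajQuadFamily (C : (n : ℕ) → MajQuadCkt n) : Prop := ∃ p : Polynomial ℕ, ∀ n, (C n).size ≤ p.eval n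

/-- PerceptronDialLawsA helper `qAccepts` (decomp-qadv land package; see the module docstring). -/
def qAccepts (C : (n : ℕ) → MajQuadCkt n) (I : CubicANFPair) : Prop := 0 < (C I.n).val (bits I)

/-- ★ the class `MAJ∘XOR∘AND₂` (non-uniform, polynomial size = polynomial weight): languages that agree on instance codes
with some polynomial-size majority-of-quadratic-phases family. -/
def MajQuad : Set (Language Bool) :=
  {L | ∃ C, IsMajQuadFamily C ∧ ∀ I : CubicANFPair, I.encode ∈ L ↔ qAccepts C I}

/-! ## §2 The rungs and the residual -/

/-- ★ [W₁ · DECIDED below (`thrRungNU`)] the non-uniform perceptron rung: no polynomial-size `THR∘XOR` family with arbitrary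
real weights answers the sign of exact cubic Forrelation. -/
def ThrRungNU : Prop := SignedExactCubicSliceANF ∉ promiseLift ThrXor

/-- ★ [W₁ᵘ · NECESSARY for `X` · DECIDED (`thrRung`)] the uniform perceptron rung. -/
def ThrRung : Prop := SignedExactCubicSliceANF ∉ promiseLift (ThrXor ∩ Classes.P)

/-- ★ [W₂ · STRONGER than `VoteRung2` · the line target] no polynomial-size `MAJ∘XOR∘AND₂` family answers the sign. -/
def VoteRung2NU : Prop := SignedExactCubicSliceANF ∉ promiseLift MajQuad

/-- ★★ [W₂ᵘ · NECESSARY for `X` · WEAKER · UNDECIDED · ATTACKABLE] the uniform quadratic-vote rung: no polynomial-time language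
whose restriction to codes is a polynomial-size majority of quadratic phases answers the sign. -/
def VoteRung2 : Prop := SignedExactCubicSliceANF ∉ promiseLift (MajQuad ∩ Classes.P)

/-- ★ [declared RESIDUAL · shape A · IDEA-NEEDED] from the `AC⁰[⊕] ∩ P` rung AND the quadratic-vote rung to promise-`BPP`
hardness. -/
def PercLift : Prop := RungA → VoteRung2 → AnfResidual

/-! ## §3 The certified translations: `promiseLift` statements ARE circuit lower bounds -/

/-- a `THR∘XOR` family ANSWERS THE SIGN: accepts every even-arity instance of value `1`, rejects every one of value `-1`. -/
def SolvesSignT (C : (n : ℕ) → ThrXorCkt n) : Prop :=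
  ∀ I : CubicANFPair, Even I.n → (I.value = 1 → tAccepts C I) ∧ (I.value = -1 → ¬ tAccepts C I)

/-- a `MAJ∘XOR∘AND₂` family ANSWERS THE SIGN. -/
def SolvesSignQ (C : (n : ℕ) → MajQuadCkt n) : Prop :=
  ∀ I : CubicANFPair, Even I.n → (I.value = 1 → qAccepts C I) ∧ (I.value = -1 → ¬ qAccepts C I)

/-- the language cut out by a perceptron family -/
def langT (C : (n : ℕ) → ThrXorCkt n) : Language Bool := {w | ∃ I : CubicANFPair, I.encode = w ∧ tAccepts C I}

/-- the language cut out by a quadratic-vote family -/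
def langQ (C : (n : ℕ) → MajQuadCkt n) : Language Bool := {w | ∃ I : CubicANFPair, I.encode = w ∧ qAccepts C I}

/-- PerceptronDialLawsA helper `mem_langT_iff` (decomp-qadv land package; see the module docstring). -/
theorem mem_langT_iff (C : (n : ℕ) → ThrXorCkt n) (I : CubicANFPair) : I.encode ∈ langT C ↔ tAccepts C I :=
  ⟨fun ⟨J, hJ, h⟩ => by rw [← CubicANFPair.encode_injective hJ]; exact h, fun h => ⟨I, rfl, h⟩⟩

/-- PerceptronDialLawsA helper `mem_langQ_iff` (decomp-qadv land package; see the module docstring). -/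
theorem mem_langQ_iff (C : (n : ℕ) → MajQuadCkt n) (I : CubicANFPair) : I.encode ∈ langQ C ↔ qAccepts C I :=
  ⟨fun ⟨J, hJ, h⟩ => by rw [← CubicANFPair.encode_injective hJ]; exact h, fun h => ⟨I, rfl, h⟩⟩

/-- PerceptronDialLawsA helper `langT_mem` (decomp-qadv land package; see the module docstring). -/
theorem langT_mem {C : (n : ℕ) → ThrXorCkt n} (hC : IsThrXorFamily C) : langT C ∈ ThrXor := ⟨C, hC, mem_langT_iff C⟩

/-- PerceptronDialLawsA helper `langQ_mem` (decomp-qadv land package; see the module docstring). -/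
theorem langQ_mem {C : (n : ℕ) → MajQuadCkt n} (hC : IsMajQuadFamily C) : langQ C ∈ MajQuad := ⟨C, hC, mem_langQ_iff C⟩

/-- ★ [translation, perceptron dial] `ThrRungNU ↔` no polynomial-size `THR∘XOR` family answers the sign. -/
theorem thrRungNU_iff : ThrRungNU ↔ ∀ C, IsThrXorFamily C → ¬ SolvesSignT C := by
  constructor
  · intro h C hC hS
    refine h ⟨langT C, langT_mem hC, fun w hw => ?_, fun w hw => ?_⟩
    · obtain ⟨I, ⟨he, hv⟩, rfl⟩ := hw
      exact (mem_langT_iff C I).2 ((hS I he).1 hv)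
    · obtain ⟨I, ⟨he, hv⟩, rfl⟩ := hw
      exact fun hL => (hS I he).2 hv ((mem_langT_iff C I).1 hL)
  · rintro H ⟨L, ⟨C, hC, hagree⟩, hyes, hno⟩
    refine H C hC fun I he => ⟨fun hv => ?_, fun hv hacc => ?_⟩
    · exact (hagree I).1 (hyes ((CubicANFPair.encode_mem_yes_iff I).2 ⟨he, hv⟩))
    · exact hno ((CubicANFPair.encode_mem_no_iff I).2 ⟨he, hv⟩) ((hagree I).2 hacc)

/-- ★★ [THE ONE EQUIV of this node — the certified translation of the OPEN piece] `VoteRung2NU ↔` no polynomial-size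
majority of quadratic phases answers the sign of exact cubic Forrelation. -/
theorem voteRung2NU_iff : VoteRung2NU ↔ ∀ C, IsMajQuadFamily C → ¬ SolvesSignQ C := by
  constructor
  · intro h C hC hS
    refine h ⟨langQ C, langQ_mem hC, fun w hw => ?_, fun w hw => ?_⟩
    · obtain ⟨I, ⟨he, hv⟩, rfl⟩ := hw
      exact (mem_langQ_iff C I).2 ((hS I he).1 hv)
    · obtain ⟨I, ⟨he, hv⟩, rfl⟩ := hw
      exact fun hL => (hS I he).2 hv ((mem_langQ_iff C I).1 hL)
  · rintro H ⟨L, ⟨C, hC, hagree⟩, hyes, hno⟩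
    refine H C hC fun I he => ⟨fun hv => ?_, fun hv hacc => ?_⟩
    · exact (hagree I).1 (hyes ((CubicANFPair.encode_mem_yes_iff I).2 ⟨he, hv⟩))
    · exact hno ((CubicANFPair.encode_mem_no_iff I).2 ⟨he, hv⟩) ((hagree I).2 hacc)

/-- [translation, uniform form] `VoteRung2 ↔` no polynomial-size quadratic-vote family that agrees on codes with SOME
polynomial-time language answers the sign. -/
theorem voteRung2_iff : VoteRung2 ↔ ∀ C, IsMajQuadFamily C →
    (∃ L ∈ Classes.P, ∀ I : CubicANFPair, I.encode ∈ L ↔ qAccepts C I) → ¬ SolvesSignQ C := by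
  constructor
  · rintro h C hC ⟨L, hLP, hagree⟩ hS
    refine h ⟨L, ⟨⟨C, hC, hagree⟩, hLP⟩, fun w hw => ?_, fun w hw => ?_⟩
    · obtain ⟨I, ⟨he, hv⟩, rfl⟩ := hw
      exact (hagree I).2 ((hS I he).1 hv)
    · obtain ⟨I, ⟨he, hv⟩, rfl⟩ := hw
      exact fun hL => (hS I he).2 hv ((hagree I).1 hL)
  · rintro H ⟨L, ⟨⟨C, hC, hagree⟩, hLP⟩, hyes, hno⟩
    refine H C hC ⟨L, hLP, hagree⟩ fun I he => ⟨fun hv => ?_, fun hv hacc => ?_⟩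
    · exact (hagree I).1 (hyes ((CubicANFPair.encode_mem_yes_iff I).2 ⟨he, hv⟩))
    · exact hno ((CubicANFPair.encode_mem_no_iff I).2 ⟨he, hv⟩) ((hagree I).2 hacc)

/-! ## §4 The inner-product face: a literal projection of `IP_k` INTO the exact slice (the dictionary behind W₁) -/

section IPFace

variable (k)

/-- the identity key pattern -/
def δ : Fin k → Fin k → Bool := fun a => sgl a

variable {k}

/-- PerceptronDialLawsA helper `mv_δ` (decomp-qadv land package; see the module docstring). -/
theorem mv_δ (x : Fin k → Bool) : mv (δ k) x = x := funext fun a => bd_sgl_left a x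

/-- PerceptronDialLawsA helper `bd_comm` (decomp-qadv land package; see the module docstring). -/
theorem bd_comm (u v : Fin k → Bool) : bd u v = bd v u := by
  unfold Summit.QuantumAdvantage.QuantumAdvantage.Theorems.HintDial.Automaton.bd
  simp only [Bool.and_comm]

/-- PerceptronDialLawsA helper `bd_bxor_left` (decomp-qadv land package; see the module docstring). -/
theorem bd_bxor_left (p q x : Fin k → Bool) : bd (bxor p q) x = xor (bd p x) (bd q x) := by
  rw [bd_comm, bd_bxor_right, bd_comm x p, bd_comm x q]

/-- `bd` is the inner product function `ipBool` of `InnerProductDiscrepancy.lean` (argument order immaterial). -/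
theorem bd_eq_ipBool (s t : Fin k → Bool) : bd t s = ipBool s t := by
  rw [bd_comm]
  unfold Summit.QuantumAdvantage.QuantumAdvantage.Theorems.HintDial.Automaton.bd ipBool
  rfl

variable (s t : Fin k → Bool) (c : Bool)

/-- ★ the IP face, form `F_{s,t}(x′,x″) = ⟨s,x′⟩ ⊕ ⟨x′,x″⟩ ⊕ ⟨t,x″⟩` (a quadratic Maiorana–McFarland bent function, identity key). -/
def ipF : CubicForm (k + k) := blTable k false s (δ k) t

/-- ★ the IP face, form `G_{s,t,c}(y′,y″) = c ⊕ ⟨t,y′⟩ ⊕ ⟨y′,y″⟩ ⊕ ⟨s,y″⟩`: for `c = ⟨t,s⟩` this IS the dual `F̃_{s,t}`, for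
`c = ¬⟨t,s⟩` its complement. -/
def ipG : CubicForm (k + k) := blTable k c t (δ k) s

/-- ★ the planted instance `I(s,t,c) = (F_{s,t}, G_{s,t,c})` on `n = 2k` variables. -/
def ipInst : CubicANFPair := ⟨k + k, ipF s t, ipG s t c⟩

/-- its table bits -/
def ipBits : AnfIdx (k + k) → Bool := bits (ipInst s t c)

/-- `G_{s,t,⟨t,s⟩}` evaluates to the Maiorana–McFarland dual function of `F_{s,t}`. -/
theorem eval_ipG_dual : (ipG s t (bd t s)).eval = dualFn false s (δ k) t := by
  funext y
  obtain ⟨⟨y₁, y₂⟩, rfl⟩ := (Fin.appendEquiv k k).surjective y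
  show (ipG s t (bd t s)).eval (Fin.append y₁ y₂) = dualFn false s (δ k) t (Fin.append y₁ y₂)
  rw [ipG, eval_blTable, dualFn_append, mv_δ, mv_δ, bd_bxor_right, bd_bxor_left]
  generalize bd t s = P; generalize bd t y₁ = Q; generalize bd y₁ y₂ = R; generalize bd s y₂ = U
  cases P <;> cases Q <;> cases R <;> cases U <;> rfl

/-- ★ exactness, positive sign: `Φ(F_{s,t}, G_{s,t,⟨t,s⟩}) = 1`. -/
theorem value_ipInst_pos : (ipInst s t (bd t s)).value = 1 := by
  show forrelation (ipF s t).eval (ipG s t (bd t s)).eval = 1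
  rw [eval_ipG_dual]
  exact forrelation_eq_one_of_isDualOf (isDualOf_blTable (c := false) (α := s) (M := δ k) (N := δ k) (β := t)
    fun x => by rw [mv_δ, mv_δ])

/-- ★ exactness, negative sign: `Φ(F_{s,t}, G_{s,t,¬⟨t,s⟩}) = -1`. -/
theorem value_ipInst_neg : (ipInst s t (!(bd t s))).value = -1 := by
  have e : ipG s t (!(bd t s)) = flipConst (ipG s t (bd t s)) := rfl
  show (⟨k + k, ipF s t, ipG s t (!(bd t s))⟩ : CubicANFPair).value = -1
  rw [e, value_flipConst]
  exact congrArg Neg.neg (value_ipInst_pos s t)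


end IPFace
end Summit.QuantumAdvantage.QuantumAdvantage.Theorems.PerceptronDial
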